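import Mathlib
import HarnessLib
import HarnessLib.Audit
import Summits.CriticalPhenomena.Statement
import Literature.Probability.RandomPlanarGeometry.ChordalCurveFamily
import Literature.Probability.RandomPlanarGeometry.ConformalRestrictionProofs
import Literature.Probability.RandomPlanarGeometry.SLEConvergenceCriterion
import HarnessLib.Audit.Status.Attr

/-!
Route: SAWPoincareChain

DORMANT since 2026-08-22T05:22:56Z (reconciler: no traction for 5.1 d (last activity item-evidence-added at 2026-08-17T02:28:36Z); parked, not closed — `ledger route dormant route-CriticalPhenomena-SAWPoincareChain --off` to reactivate) — unstaffed, not closed; items shared with open routes are served there. `ledger route dormant <id> --off` reactivates.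

# Route SAWPoincareChain — hyperbolic habitat — exactly Möbius-covariant Poincaré chain; LSW
restriction = "obstacle equals metric"; SLE(8/3) by proved LSW03

It suffices to show X = C0 ∧ TC ∧ T ∧ Z for the POINCARÉ CHAIN of card
poincare-chain-exact-conformal-covariance-v2
(spine; the only card realised): the self-avoiding tangent-bead chain whose steps have fixed
Poincaré length ε
(t = tanh(ε/2)) in a simply connected domain, taken grand-canonically between the two marked IDEAL
boundary points
at the FLAT critical fugacity x_c = 1/μ_flat. C0 (ChainLaw, construction): the chordal chain laws Q
t exist as limits
of explicit finite approximants in (𝔻; 1, −1) and form an EXACTLY conformally covariant chordal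
family at every
small t (conformal maps are isometries of the Poincaré metrics). TC (ObstacleIsMetric):
subsequential limits as
t → 0+ have LSW's two-sided restriction property — by exact covariance + restriction-as-conditioning
this is the single
universality statement "carving a hull out of 𝔻 or running the chain in the complement's own metric
gives the same
limit". T (SubCurvatureTightness): tightness and simple limits at sub-curvature scales. Z
(LatticeJoinsChain): the
critical δℤ² SAW law and the chain law are asymptotically equal in every Dobrushin domain. LSW03,
PROVED in the tree
(LawlerSchrammWerner2003_holds), then identifies every limit as chordal SLE_{8/3}.
Lean: `ChainLaw ∧ ObstacleIsMetric ∧ SubCurvatureTightness ∧ LatticeJoinsChain`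

## Assembly
Bookkeeping over PROVED tree facts, no mathematics hidden: take Q from ChainLaw (modified outside
the eventual set so
that every Q t 𝔻 is a probability measure); by SubCurvatureTightness and Prokhorov
(IsTightAlongMesh.exists_subseq)
subsequential limits μ exist along every t_n → 0+ and are simple; they are chordal in (𝔻;1,−1)
(closed support
conditions, portmanteau) and invariant under the stabiliser of (𝔻;1,−1) (exact covariance of Q t at
each t, continuity
of CurveClass.map Φ); ObstacleIsMetric gives hull restriction; DiscRestrictionIsSLE identifies μ as
the SLE_{8/3} law;
convergesInLawToSLE_of_isTightAlongMesh (with IsSLECurve.map_eq_holds) upgrades this to convergence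
of Q t 𝔻 along
t → 0+; DiscToDomains moves it to every D; LatticeJoinsChain plus composition of limits along e(δ) →
0+ transfers it
to SAW.law, and integral_map with SAW.aemeasurable_curve gives ConvergesInLawToSLE (8/3) D for every
endpoint
approximation, i.e. SAWScalingLimit.

Rationale: WHY THIS LINE. Hang the polymer in the hyperbolic plane: a chain whose steps have fixed POINCARÉ
length is mapped to a chain of the
same kind by every conformal map, so in the one geometry whose conformal automorphisms are all
isometries conformal
covariance of the chordal law is an identity at every step size, restriction-by-conditioning is a
tautology of the
Gibbs weights, and Lawler–Schramm–Werner's characterisation (LawlerSchrammWerner2003Restriction p.5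
result 2, Prop. 3.3,
Thm 6.1 — proved in the tree as
Literature.Probability.RandomPlanarGeometry.LawlerSchrammWerner2003_holds) leaves exactly
ONE analytic statement, obstacle = metric (crux TC): the polymer version of the open
density-invariance half of
Benjamini–Schramm's decomposition "conformal invariance = conformal change of metric + density
invariance"
(BenjaminiSchramm1998), here with the metric half free. Imported areas: hyperbolic geometry and
nonamenable-SAW
technology for the construction and the large scales (arXiv:2007.03534 Thm 1.1 — ballisticity of
exactly this continuum
chain at unit step; arXiv:1709.10515 Thms 1.3–1.4; arXiv:1908.00127), LSW restriction theory for
identification, and the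
flat critical fugacity as the conformal point (solvable check: for the free chain x_c = 1 gives the
random-walk bridge,
finite by transience although Σ_n 1 = ∞, converging to the Brownian excursion = LSW's P_1;
fugacities off x_c give the
Möbius-covariant but non-restriction "hyperbolically massive" family of arXiv:0909.5377 type, so TC
is exactly the
missing axiom). What prior routes do not do: in SAWConfRestriction / SAWRestrictionRigidity /
SAWInfinitesimalRigidity
covariance or rigidity of the ℤ² limit is itself a crux, in SAWGaussianRotation / SAWHexUniversality
/ SAWQuantumGravity
a symmetry is imported from another habitat, in SAWEdwardsStrongCoupling covariance inside Wiener
space costs profile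
universality; here covariance costs nothing, the identification engine is a proved cone fact, and
the residue is one
typed universality statement about two curvature −1 chains plus the lattice-universality step Z that
every habitat
route shares (typing pattern ∃Q-pinned-by-explicit-approximants borrowed from
SAWEdwardsStrongCoupling).

RANKED CRUXES. #2 ObstacleIsMetric (crux) — (card TC, "obstacle = metric") For every Q with the
ChainLaw property and every subsequential weak limit μ (t_n → 0+) of the disc laws Q t (𝔻;1,−1): μ
has LSW's two-sided restriction property over hull subdomains U of the unit disc, the law in U being
the conformal transport of μ itself (any conformal g : 𝔻 → U with boundary values 1 ↦ 1, −1 ↦ −1,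
any continuous Φ extending g): Φ_*μ(T) · μ{γ ⊆ Ū} = μ(T ∩ {γ ⊆ Ū}). At each t, conditioning the
chain of 𝔻 on {γ ⊆ Ū} IS the chain of U run with 𝔻's Poincaré metric (hereditary hard core, product
weights) and Φ_*(Q t 𝔻) = Q t U IS the chain of U with U's own metric (exact covariance), so the
statement reads: lim (obstacle carved out) = lim (metric opened up); weak one-variable shadow q_t(d)
→ 1 − tanh^{5/4} d for a geodesic obstacle at hyperbolic distance d. [deps: ChainLaw] [difficulty:
open-problem] (why it might fail: A wall-layer effect: the U-metric chain's infinitely refined steps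
at ∂U versus the 𝔻-metric chain's hard wall may differ by an effective attraction; past the
adsorption threshold conditioned and transported limits differ and restriction is FALSE for
isotropic chains at x_c (MC on q_t(d) decides).) [LawlerSchrammWerner2003Restriction,
BenjaminiSchramm1998, arXiv:0909.5377, LawlerSchrammWerner2004SAW]
#3 ChainLaw (crux) — (construction statement of the posited object; card C0 + F1) There is Q : ℝ →
ChordalFamily such that for all small t > 0: Q t is chordal, EXACTLY conformally covariant
(ChordalFamily.IsConformallyCovariant), and Q t (𝔻;1,−1) is the weak limit as ρ = 1 − r → 1⁻ of the
normalised Poincaré-chain approximants, INLINED: tangent-bead chains v₀ = ρ, v_{k+1} = (v_k + t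
e^{iθ_k})/(1 + v̄_k t e^{iθ_k}) (θ_k uniform on [0,2π); a hyperbolic step of length ε, t =
tanh(ε/2), uniform hyperbolic angle), hard core |v_i − v_j| > t·|1 − v̄_i v_j| for |i − j| ≥ 2
(pseudo-chordal distance > t: tangent beads, hence simple polygons), last bead within pseudo-chordal
distance 1/2 of −ρ, weight x_c^n on n-step chains with x_c = 1/μ_flat, μ_flat = inf_n
p_{n+1}^{1/(n+1)}, p_n the survival probability of the FLAT unit-step tangent-disc chain
(scale-free, hence ε-independent); pushed to CurveClass ℂ as polylines; normalised by total mass.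
Intended: Q t D = the bi-infinite Poincaré chain of (D; a, b); exact covariance because conformal
maps are Poincaré isometries and the chordal law is invariant under the axis translations of
(𝔻;1,−1). [difficulty: XL] (why it might fail: Typed at x = 1/μ_flat exactly: needs the t-chain's
two-point function finite there (bulk mass m > 1/2, predicted 5/8) and a ρ → 1 limit insensitive to
moving the two ends separately; a curvature shift of the conformal fugacity or a fixed-t
Martin-boundary pathology falsifies it as typed.) [arXiv:2007.03534, arXiv:1612.04169,
arXiv:1709.10515, arXiv:1908.00127, MadrasSlade1993,
Literature.Barriers.CriticalPhenomena.SAWNotKineticallyGrown]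
#4 SubCurvatureTightness (crux) — (card T; the flat problem, off lattice, at sub-curvature scales)
For every Q with the ChainLaw property the disc laws Q t (𝔻;1,−1) are tight as t → 0+ in the
EVENTUAL sense (IsTightAlongMesh of the identity variable — never the all-t form refuted as
stmt-CriticalPhenomena-0772 for ℤ²), and every subsequential limit is carried by simple curves
meeting the unit circle only at 1 and −1. Foreseen tools: Aizenman–Burchard via annulus-crossing
bounds for bead chains (Hammersley–Welsh unfolding and Kesten's bridge identity redone off lattice),
hyperbolic large scales free (ballisticity, renewal at singly crossed transversal geodesics). [deps:
ChainLaw] [difficulty: open-problem] (why it might fail: No RSW/annulus-crossing technology exists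
for SAW-type chains at criticality (only sub-ballisticity, arXiv:2310.17299); off lattice even
Hammersley–Welsh must be rebuilt for bead chains; limits could be non-simple or creep along ∂𝔻 away
from ±1.) [AizenmanBurchard1999, KemppainenSmirnov2017, arXiv:2310.17299, MadrasSlade1993,
DuminilCopinSmirnov2012]
#5 LatticeJoinsChain (crux) — (card Z; conjunct-facing universality, NO mechanism claimed) For every
Q with the ChainLaw property, every Dobrushin domain (Ω; a, b) and every ℤ² endpoint approximation
(SAW.IsEndpointApprox) there is a step schedule e(δ) → 0+ along which the critical δℤ² SAW law
(SAW.law, pushed to curves) and the chain law Q (e δ) (Ω;a,b) are asymptotically equal on bounded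
continuous test functions. With the other cruxes this is equivalent to the conjunct; it isolates
lattice universality ℤ² ↔ Poincaré chain as the one ℤ²-specific statement of the line. [deps:
ChainLaw] [difficulty: open-problem] (why it might fail: Lattice universality is open with no
mechanism (MadrasSlade1993 §1.1); Kennedy–Lawler lattice correction factors show endpoint-level
non-universality, so only interior laws can agree — a different ℤ² limit, or none, kills this
conjunct-facing step while the chain theory survives.) [MadrasSlade1993, doi:10.1090/conm/601/11958,
arXiv:math/0112246, LawlerSchrammWerner2004SAW, DuminilCopinSmirnov2012]
#9 DiscRestrictionIsSLE (support) — LSW03 p.5 result 2 in ONE reference domain: a probability law on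
CurveClass ℂ carried by curves in the closed unit disc from 1 to −1, invariant under the disc
automorphisms fixing 1 and −1 (pushed along any continuous extension), having the
hull-restriction-with-transport property that ObstacleIsMetric delivers, and carried by simple
curves touching the circle only at ±1, is the chordal SLE_{8/3} law of (𝔻;1,−1) (IsSLELaw (8/3)
DobrushinDomain.unitDisc). Proof: transport μ along Riemann maps (Carathéodory, Tietze for Φ) to a
chordal family and apply the PROVED
Literature.Probability.RandomPlanarGeometry.LawlerSchrammWerner2003_holds, or pull back to ℍ and use
RestrictionUniqueness directly. [difficulty: L] [LawlerSchrammWerner2003Restriction,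
Literature.Probability.RandomPlanarGeometry.LawlerSchrammWerner2003_holds]
#9 DiscToDomains (support) — Transport of convergence: if Q t is eventually chordal and exactly
conformally covariant and Q t (𝔻;1,−1) converges weakly as t → 0+ to an SLE_{8/3} law of the disc,
then for every Dobrushin domain D the laws Q t D converge to an SLE_{8/3} law of D (Riemann map 𝔻 →
D with the two boundary values, Tietze extension Φ, continuity of CurveClass.map Φ, and the SLE
transport IsSLECurve.of_through / IsCompactifiedImage; uniqueness IsSLECurve.map_eq_holds).
[difficulty: M] [LawlerSchrammWerner2004SAW, BillingsleyCPM1999,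
Literature.Probability.RandomPlanarGeometry.IsSLECurve.map_eq_holds]

TWO-LAYER PLAN. Foreseen glued splits (k ≤ 3, depth 1), filed only when a crux closes or stalls with
a census:
ObstacleIsMetric ⇐ WallLayerNeutrality (conditioned vs transported limits agree for SMOOTH hulls at
positive distance
from ±1) → SmoothToAllHulls (LSW03 Prop. 3.3 (3)⇔(4) analogue) → ObstacleIsMetric.
ChainLaw ⇐ TwoPointFinite (Z(t,ρ) < ∞ with exponential decay in d(ρ,−ρ) at x_c, small t) →
AxisRenewal (renewal at
singly crossed transversal geodesics; spectral gap of the axis transfer operator ⇒ ρ → 1 limit and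
translation
invariance) → ChainLaw (transport to all D is glue).
LatticeJoinsChain ⇐ Z2EventualTight (shared with route SAWRenewalTightness, decl EventualTight) →
Z2SimpleLimits (shared
with SAWConfRestriction-type items) → AvoidanceUniversality (hull-avoidance probabilities of ℤ²
subsequential limits equal
those of the chain limit) → LatticeJoinsChain (glue: CurveClass.Measure.ext_of_missCode_injOn, laws
on simple chords are
determined by hull-avoidance probabilities).

KILL CRITERIA. ¬ObstacleIsMetric — by proof, or by a refuter's certified Monte Carlo showing q_t(d)
→ 1 − tanh^{2α} d with α ≠ 5/8 or a
non-product form — closes the route outright (`close --reason refuted:ObstacleIsMetric`; negative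
knowledge worth having:
conformal restriction fails for isotropic off-lattice chains at the flat critical fugacity).
¬ChainLaw AS TYPED (two-point
function infinite at 1/μ_flat, or no ρ → 1 limit) forces a pivot, not a close: restate C0 with an
intrinsic fugacity
schedule x(t) → 1/μ_flat (e.g. pinned by bulk mass 5/8). ¬SubCurvatureTightness by non-simple limits
closes the line
(restriction + non-simple ⇒ α > 5/8, a different universality class); by mere failure of tightness
in this topology ⇒
restate. ¬LatticeJoinsChain kills the conjunct-facing claim: close `refuted:LatticeJoinsChain` (the
chain results
survive as Literature). SAWScalingLimit proved by any other route moots this one; a proof of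
ObstacleIsMetric alone is a
publishable theorem (Poincaré chain → SLE_{8/3} given T).

NOT DECOMPOSED YET. The bi-infinite chain as a Gibbs/DLR object and its Markov/renewal screens (only
its law as a limit is typed); the
smooth-hull reduction inside TC; the portmanteau step (conditioning passes to the limit because
limits do not graze ∂U);
the entire ℤ² side beyond Z (tightness and simplicity of the ℤ² SAW are other routes' items and
would be re-attached, not
re-filed); convention independence (end-ball radius ln 3, tangent-bead versus Benjamini–Panagiotis
hard core c·ε, start
on the axis) — expected immaterial, a support item later if a prover needs it. No third layer will
be filed.

CHEAPEST FALSIFIER. Monte Carlo, two parameter-free curves (not run here: one-shot plancard seat, no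
kit job submitted): the pivot algorithm
runs verbatim for the tangent-bead chain in 𝔻 (pivots = disc isometries fixing a bead); (i) measure
μ_flat with the same
code in flat space, then at x = 1/μ_flat and t = 0.3, 0.2, 0.1 the avoidance probability of the
hyperbolic half-plane
beyond a geodesic at distance d from the axis against 1 − tanh^{5/4} d (ObstacleIsMetric's shadow; a
drift to tanh^{2α}d
with α ≠ 5/8 kills TC); (ii) grand-canonical runs for Z(t,ρ): finite at 1/μ_flat? decay rate per
unit hyperbolic length
→ 5/8? (kills ChainLaw as typed if not). Lookup falsifier already run: no paper treats a
fugacity-weighted or chordal SAW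
in ℍ² (lit search / galaxy, see Novelty), so no known theorem settles either crux.

NUMBERS. Restriction exponent α = 5/8 and P[γ ∩ A = ∅] = Φ'_A(0)^{5/8}
(LawlerSchrammWerner2003Restriction Thm 6.1); for the
geodesic obstacle at hyperbolic distance d from the axis Φ'_A(0) = tanh² d, so q(d) = 1 − tanh^{5/4}
d ≈ (5/2)e^{−2d};
Brownian excursion (free chain, x_c = 1): 1 − tanh² d (α = 1). Predicted bulk mass of the critical
chain m = h_{1,2} = 5/8
per unit hyperbolic length (card), susceptibility threshold m = 1, two-point finiteness needs m >
1/2. Curvature window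
exponent 4/3 = 1/ν (ν = 3/4); per-blob fugacity defect at x = 1/μ_flat is O(t^{2/3}) → 0 (energy
operator x_ε = 2/3),
which is why no curvature correction of x_c is typed. μ(ℤ²) ∈ [2.6, 2.7] (LawlerSchrammWerner2004SAW
§3.1); μ_flat of
the planar tangent-disc chain (relative to the free chain, so in (0,1], ≥ 1/6 by monotone chains) is
not in the
searched literature — to be measured. Items at open: 7 (4 cruxes, 2 support, 1 assembly).

DEFINITION REQUESTS. To shorten the inlined gadget (filed after open, `--kind definition --topic
Summits/CriticalPhenomena/SAWScalingLimit/Theorems --for <ChainLaw item>`):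
PoincareChain.approximant (t ρ : ℝ) : Measure (CurveClass ℂ) (the unnormalised x_c-weighted
tangent-bead chain measure of
ChainLaw, with its flat companion flatBeadSurvival (n : ℕ) : ℝ and flatBeadCriticalFugacity : ℝ);
once landed, the four
cruxes can be re-signed with the named gadget by set-signature (same normalised meaning). Mathlib
has UpperHalfPlane.dist
but no Poincaré-disc metric and no off-lattice SAW; Literature has polyline, CurveClass,
ChordalFamily, TendstoLaw,
IsTightAlongMesh, IsSubseqLimitLaw, ConformalEquiv, IsSLELaw (all used, all `lean check`ed in
Sketch.lean).

Novelty: Searches (2026-08-15): `lit search "self-avoiding walk hyperbolic plane scaling limit conformal"`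
(local 7 pp, s2 15 +
crossref 15; openalex/arxiv HTTP 429) → 1 relevant: Benjamini–Panagiotis doi:10.1214/21-ecp388 =
arXiv:2007.03534 (read
pp. 3, 6); `lit galaxy search --star all` ×3 ("self-avoiding walk on the hyperbolic plane",
"self-avoiding walk
hyperbolic", "hyperbolic self-avoiding"): 0 hits each; `lit galaxy search --star pdf --mode
intelligent` (SAW/polymers in
hyperbolic space, fugacity, two-point decay, conformal invariance): 12 hits, none on the subject
(nearest: hard-disc fluids
in negative curvature arXiv:0801.1166); `lit frontier CriticalPhenomena --since 2022` (30 rows, none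
hyperbolic or
off-lattice; arXiv:2310.17299 noted for T); `lit bridges CriticalPhenomena --cross any` (noise); the
card's audit read
BenjaminiSchramm1998 pp. 1–3 and arXiv:0909.5377 pp. 3–5; in-project: 23 Theses files of the sub
grepped for
hyperbolic/Poincaré (none), cards poisson-honeycomb-density-gradient (Variant H) and
self-avoiding-worm-anchor read via the
spine card's Distinguishes.
Nearest prior art found: arXiv:2007.03534 (Benjamini–Panagiotis, ECP 2021): the (n, ε)-SAW in ℍ^d
with uniform ε-sphere
steps and hard core, Thm 1.1 ballisticity at ε = 1, Conjectures 3.1–3.2 on the canonical ε → 0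
window — no fugacity, no
marked points, no conformal or SLE statement; BenjaminiSchramm1998 (architecture "CI = metric change
+ density
invariance" for Voronoi percolation); route SAWEdwardsStr  [refs: 10.1214/21-ecp388, 2007.03534, 0801.1166, 2310.17299, 0909.5377, doi:10.1214/21-ecp388, BenjaminiSchramm1998]

Barriers (technique_class: exact-symmetry-habitat, conformal-restriction, hyperbolic): - technique_class: exact-symmetry-habitat, conformal-restriction, hyperbolic
- Literature.Barriers.CriticalPhenomena.EmbeddingModulusUniqueness: evaded — there is no lattice or
embedding to shear (a linear image of a Poincaré chain is not the Poincaré chain of any domain, so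
Beffara's conjugation has no object), and covariance is an identity of the model, not an upgrade;
the barrier's moral "symmetry does not identify the limit" survives exactly as crux ObstacleIsMetric
(the off-critical Möbius-covariant massive family shows it is load-bearing).
- Literature.Barriers.CriticalPhenomena.ScaleCovarianceNotMoebius: catalogued for Ising3D; here full
Möbius covariance holds exactly at every t, nothing is upgraded from partial symmetry.
- Literature.Barriers.CriticalPhenomena.SAWNotKineticallyGrown: applies in spirit to ChainLaw — the
chain is configurational (Gibbs weights) and its infinite-volume chordal law is typed as a LIMIT,
not grown; the ℤ² analogue (existence of the infinite SAW) is open (Lawler 2005 §0.3); the bet is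
that nonamenability/ballisticity (arXiv:2007.03534 Thm 1.1, arXiv:1709.10515) delivers the
hyperbolic chordal limit at fixed t.
- Literature.Barriers.CriticalPhenomena.SupercriticalSAWSpaceFilling: x_c^flat exceeds 1/μ_hyp(t)
(susceptibility-supercritical in ℍ²) but is two-point-subcritical and the typed law is two-point
normalised; the barrier's dense phase needs x above the LOCAL (flat) critical fugacity, which the
per-blob defect O(t^{2/3}) → 0 excludes.
-

Novelty grade: new-combination — ROUTE REVIEW (refuter rreview b4b00054, 2026-08-15): SOUND AS TYPED; 2 objections filed as notes, nothing blocked; per-item briefings are on 7555-7561 (all stamped elaborates=true). (1) Route file not yet in tree (rev 0): all 7 bodies re-elaborated verbatim from the ledger signatures (W_SAW.lean, rc (refuter refuter-rreview-route-CriticalPhenomena--b4b00054-0, 2026-08-15T14:04:46Z; prior: arXiv:2007.03534, BenjaminiSchramm1998, arXiv:0909.5377, LawlerSchrammWerner2003Restriction, LawlerSchrammWerner2004SAW, arXiv:1709.10515)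

History (route lifecycle, newest last):
- 2026-08-22T05:22:56Z · DORMANT — reconciler: no traction for 5.1 d (last activity item-evidence-added at 2026-08-17T02:28:36Z); parked, not closed — `ledger route dormant route-CriticalPhenomen (operator:999:1827225)

sub-problem: SAWScalingLimit · status: dormant · opened planner-plancard-CriticalPhenomena-SAWScaling-17565feb-0 2026-08-15T12:11:45Z · rev 2 · ledger route-CriticalPhenomena-SAWPoincareChain
GENERATED by the gate from the ledger (D-0016/17). Provers cite these decls: `theorem foo : Summit.CriticalPhenomena.SAWScalingLimit.Theses.SAWPoincareChain.<Decl> := …` in Summits/CriticalPhenomena/SAWScalingLimit/Theorems/<Name>.lean.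
-/

namespace Summit.CriticalPhenomena.SAWScalingLimit.Theses.SAWPoincareChain

open scoped BigOperators Topology Manifold Classical MeasureTheory ProbabilityTheory Matrix InnerProductSpace ComplexConjugate ContinuousMap
open Filter Set Function TopologicalSpace MeasureTheory

attribute [summit_statement] _root_.SAWScalingLimit

/-- item stmt-CriticalPhenomena-7555 · crux · rank 2 · open · by planner
why it might fail: A wall-layer effect: the U-metric chain's infinitely refined steps at ∂U versus the 𝔻-metric chain's hard wall may differ by an effective attraction; past the adsorption threshold conditioned and transported limits differ and restriction is FALSE for isotropic chains at x_c (MC on q_t(d) decides).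
sources: LawlerSchrammWerner2003Restriction, BenjaminiSchramm1998, arXiv:0909.5377, LawlerSchrammWerner2004SAW
[crux] (card TC, "obstacle = metric") For every Q with the ChainLaw property and every subsequential
weak limit μ (t_n → 0+) of the disc laws Q t (𝔻;1,−1): μ has LSW's two-sided restriction property
over hull subdomains U of the unit disc, the law in U being the conformal transport of μ itself (any
conformal g : 𝔻 → U with boundary values 1 ↦ 1, −1 ↦ −1, any continuous Φ extending g): Φ_*μ(T) ·
μ{γ ⊆ Ū} = μ(T ∩ {γ ⊆ Ū}). At each t, conditioning the chain of 𝔻 on {γ ⊆ Ū} IS the chain of U run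
with 𝔻's Poincaré metric (hereditary hard core, product weights) and Φ_*(Q t 𝔻) = Q t U IS the chain
of U with U's own metric (exact covariance), so the statement reads: lim (obstacle carved out) = lim
(metric opened up); weak one-variable shadow q_t(d) → 1 − tanh^{5/4} d for a geodesic obstacle at
hyperbolic distance d. [deps: ChainLaw] [difficulty: open-problem] -/
@[route_item "route-CriticalPhenomena-SAWPoincareChain", crux]
def ObstacleIsMetric : Prop :=
  ∀ Q : ℝ → Literature.Probability.RandomPlanarGeometry.ChordalFamily, (∀ᶠ t in nhdsWithin (0:ℝ) (Set.Ioi 0), (Q t).IsChordal ∧ (Q t).IsConformallyCovariant ∧ Literature.Probability.RandomPlanarGeometry.TendstoLaw (fun (_ : ℝ) (x : Literature.Probability.RandomPlanarGeometry.CurveClass ℂ) => x) (fun r => (fun S : MeasureTheory.Measure (Literature.Probability.RandomPlanarGeometry.CurveClass ℂ) => (S Set.univ)⁻¹ • S) ((fun (xc t ρ : ℝ) (pos : (ℕ → ℝ) → ℕ → ℂ) => MeasureTheory.Measure.sum fun n : ℕ => ENNReal.ofReal ((xc / (2 * Real.pi)) ^ n) • ((MeasureTheory.volume.restrict {θ :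 Fin n → ℝ | (∀ k, θ k ∈ Set.Ico (0:ℝ) (2 * Real.pi)) ∧ (∀ i j : ℕ, i + 2 ≤ j → j ≤ n → t * ‖1 - (starRingEnd ℂ) (pos (fun k => if h : k < n then θ ⟨k, h⟩ else 0) i) * pos (fun k => if h : k < n then θ ⟨k, h⟩ else 0) j‖ < ‖pos (fun k => if h : k < n then θ ⟨k, h⟩ else 0) i - pos (fun k => if h : k < n then θ ⟨k, h⟩ else 0) j‖) ∧ 2 * ‖pos (fun k => if h : k < n then θ ⟨k, h⟩ else 0) n + ↑ρ‖ ≤ ‖1 + ↑ρ * pos (fun k => if h : k < n then θ ⟨k, h⟩ else 0) n‖}).map (fun θ => Literature.Probability.RandomPlanarGeometry.CurveClass.mk (⟨Literature.Probability.LatticeModels.polyline ((List.range (n + 1)).map (pos (fun k => if h : k < n then θ ⟨k, h⟩ else 0)))⟩ : Literature.Probability.RandomPlanarGeometry.Curve ℂ)))) ((⨅ n : ℕ, ((MeasureTheory.volume {θ : Fin (n + 1) → ℝ | (∀ k, θ k ∈ Set.Ico (0:ℝ) (2 * Real.pi)) ∧ ∀ i j : ℕ, i + 2 ≤ j → j ≤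 n + 1 → 1 < ‖(List.range i).foldl (fun (z : ℂ) (m : ℕ) => z + Complex.exp (↑(if h : m < n + 1 then θ ⟨m, h⟩ else 0) * Complex.I)) 0 - (List.range j).foldl (fun (z : ℂ) (m : ℕ) => z + Complex.exp (↑(if h : m < n + 1 then θ ⟨m, h⟩ else 0) * Complex.I)) 0‖}).toReal / (2 * Real.pi) ^ (n + 1)) ^ (1 / ((n : ℝ) + 1)))⁻¹) t (1 - r) (fun θ k => (List.range k).foldl (fun (z : ℂ) (j : ℕ) => (z + ↑t * Complex.exp (↑(θ j) * Complex.I)) / (1 + (starRingEnd ℂ) z * (↑t * Complex.exp (↑(θ j) * Complex.I)))) (↑(1 - r) : ℂ)))) id (Q t Literature.Probability.RandomPlanarGeometry.DobrushinDomain.unitDisc)) → ∀ μ : MeasureTheory.Measure (Literature.Probability.RandomPlanarGeometry.CurveClass ℂ), MeasureTheory.IsProbabilityMeasure μ → Literature.Probability.RandomPlanarGeometry.IsSubseqLimitLaw (fun (_ : ℝ) (x : Literature.Probability.RandomPlanarGeometry.CurveClass ℂ) => x) (fun t => Q t Literature.Probability.RandomPlanarGeometry.DobrushinDomain.unitDisc)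 μ → ∀ U : Literature.Probability.RandomPlanarGeometry.DobrushinDomain, Literature.Probability.RandomPlanarGeometry.MarkedDomain.IsHullSubdomain Literature.Probability.RandomPlanarGeometry.DobrushinDomain.unitDisc U → ∀ (g : Literature.Probability.RandomPlanarGeometry.ConformalEquiv Literature.Probability.RandomPlanarGeometry.DobrushinDomain.unitDisc.carrier U.carrier) (Φ : C(ℂ, ℂ)), g.HasBoundaryValue (Literature.Probability.RandomPlanarGeometry.DobrushinDomain.unitDisc.pt 0) (Literature.Probability.RandomPlanarGeometry.DobrushinDomain.unitDisc.pt 0) → g.HasBoundaryValue (Literature.Probability.RandomPlanarGeometry.DobrushinDomain.unitDisc.pt 1) (Literature.Probability.RandomPlanarGeometry.DobrushinDomain.unitDisc.pt 1) → Set.EqOn Φ g Literature.Probability.RandomPlanarGeometry.DobrushinDomain.unitDisc.carrier → ∀ T : Set (Literature.Probability.RandomPlanarGeometry.CurveClass ℂ), MeasurableSet T → μ.map (Literature.Probability.RandomPlanarGeometry.CurveClass.map Φ) T * μ (Literature.Probability.RandomPlanarGeometry.CurveClass.rangeSubset (closure U.carrier)) = μ (T ∩ Literature.Probability.RandomPlanarGeometry.CurveClass.rangeSubset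 (closure U.carrier))

/-- item stmt-CriticalPhenomena-7556 · crux · rank 3 · open · by planner
why it might fail: Typed at x = 1/μ_flat exactly: needs the t-chain's two-point function finite there (bulk mass m > 1/2, predicted 5/8) and a ρ → 1 limit insensitive to moving the two ends separately; a curvature shift of the conformal fugacity or a fixed-t Martin-boundary pathology falsifies it as typed.
sources: arXiv:2007.03534, arXiv:1612.04169, arXiv:1709.10515, arXiv:1908.00127, MadrasSlade1993, Literature.Barriers.CriticalPhenomena.SAWNotKineticallyGrown
[crux] (construction statement of the posited object; card C0 + F1) There is Q : ℝ → ChordalFamily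
such that for all small t > 0: Q t is chordal, EXACTLY conformally covariant
(ChordalFamily.IsConformallyCovariant), and Q t (𝔻;1,−1) is the weak limit as ρ = 1 − r → 1⁻ of the
normalised Poincaré-chain approximants, INLINED: tangent-bead chains v₀ = ρ, v_{k+1} = (v_k + t
e^{iθ_k})/(1 + v̄_k t e^{iθ_k}) (θ_k uniform on [0,2π); a hyperbolic step of length ε, t =
tanh(ε/2), uniform hyperbolic angle), hard core |v_i − v_j| > t·|1 − v̄_i v_j| for |i − j| ≥ 2
(pseudo-chordal distance > t: tangent beads, hence simple polygons), last bead within pseudo-chordal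
distance 1/2 of −ρ, weight x_c^n on n-step chains with x_c = 1/μ_flat, μ_flat = inf_n
p_{n+1}^{1/(n+1)}, p_n the survival probability of the FLAT unit-step tangent-disc chain
(scale-free, hence ε-independent); pushed to CurveClass ℂ as polylines; normalised by total mass.
Intended: Q t D = the bi-infinite Poincaré chain of (D; a, b); exact covariance because conformal
maps are Poincaré isometries and the chordal law is invariant under the axis translations of
(𝔻;1,−1). [difficulty: XL] -/
@[route_item "route-CriticalPhenomena-SAWPoincareChain", crux]
def ChainLaw : Prop :=
  ∃ Q : ℝ → Literature.Probability.RandomPlanarGeometry.ChordalFamily, ∀ᶠ t in nhdsWithin (0:ℝ) (Set.Ioi 0), (Q t).IsChordal ∧ (Q t).IsConformallyCovariant ∧ Literature.Probability.RandomPlanarGeometry.TendstoLaw (fun (_ : ℝ) (x : Literature.Probability.RandomPlanarGeometry.CurveClass ℂ) => x) (fun r => (fun S : MeasureTheory.Measure (Literature.Probability.RandomPlanarGeometry.CurveClass ℂ) => (S Set.univ)⁻¹ • S) ((fun (xc t ρ : ℝ) (pos : (ℕ → ℝ) → ℕ → ℂ) => MeasureTheory.Measure.sum fun n : ℕ =>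 ENNReal.ofReal ((xc / (2 * Real.pi)) ^ n) • ((MeasureTheory.volume.restrict {θ : Fin n → ℝ | (∀ k, θ k ∈ Set.Ico (0:ℝ) (2 * Real.pi)) ∧ (∀ i j : ℕ, i + 2 ≤ j → j ≤ n → t * ‖1 - (starRingEnd ℂ) (pos (fun k => if h : k < n then θ ⟨k, h⟩ else 0) i) * pos (fun k => if h : k < n then θ ⟨k, h⟩ else 0) j‖ < ‖pos (fun k => if h : k < n then θ ⟨k, h⟩ else 0) i - pos (fun k => if h : k < n then θ ⟨k, h⟩ else 0) j‖) ∧ 2 * ‖pos (fun k => if h : k < n then θ ⟨k, h⟩ else 0) n + ↑ρ‖ ≤ ‖1 + ↑ρ * pos (fun k => if h : k < n then θ ⟨k, h⟩ else 0) n‖}).map (fun θ => Literature.Probability.RandomPlanarGeometry.CurveClass.mk (⟨Literature.Probability.LatticeModels.polyline ((List.range (n + 1)).map (pos (fun k => if h : k < n then θ ⟨k, h⟩ else 0)))⟩ : Literature.Probability.RandomPlanarGeometry.Curve ℂ)))) ((⨅ n : ℕ, ((MeasureTheory.volume {θ : Fin (n + 1) → ℝ | (∀ k, θ k ∈ Set.Ico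 (0:ℝ) (2 * Real.pi)) ∧ ∀ i j : ℕ, i + 2 ≤ j → j ≤ n + 1 → 1 < ‖(List.range i).foldl (fun (z : ℂ) (m : ℕ) => z + Complex.exp (↑(if h : m < n + 1 then θ ⟨m, h⟩ else 0) * Complex.I)) 0 - (List.range j).foldl (fun (z : ℂ) (m : ℕ) => z + Complex.exp (↑(if h : m < n + 1 then θ ⟨m, h⟩ else 0) * Complex.I)) 0‖}).toReal / (2 * Real.pi) ^ (n + 1)) ^ (1 / ((n : ℝ) + 1)))⁻¹) t (1 - r) (fun θ k => (List.range k).foldl (fun (z : ℂ) (j : ℕ) => (z + ↑t * Complex.exp (↑(θ j) * Complex.I)) / (1 + (starRingEnd ℂ) z * (↑t * Complex.exp (↑(θ j) * Complex.I)))) (↑(1 - r) : ℂ)))) id (Q t Literature.Probability.RandomPlanarGeometry.DobrushinDomain.unitDisc)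

/-- item stmt-CriticalPhenomena-7557 · crux · rank 4 · open · by planner
why it might fail: No RSW/annulus-crossing technology exists for SAW-type chains at criticality (only sub-ballisticity, arXiv:2310.17299); off lattice even Hammersley–Welsh must be rebuilt for bead chains; limits could be non-simple or creep along ∂𝔻 away from ±1.
sources: AizenmanBurchard1999, KemppainenSmirnov2017, arXiv:2310.17299, MadrasSlade1993, DuminilCopinSmirnov2012
[crux] (card T; the flat problem, off lattice, at sub-curvature scales) For every Q with the
ChainLaw property the disc laws Q t (𝔻;1,−1) are tight as t → 0+ in the EVENTUAL sense
(IsTightAlongMesh of the identity variable — never the all-t form refuted as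
stmt-CriticalPhenomena-0772 for ℤ²), and every subsequential limit is carried by simple curves
meeting the unit circle only at 1 and −1. Foreseen tools: Aizenman–Burchard via annulus-crossing
bounds for bead chains (Hammersley–Welsh unfolding and Kesten's bridge identity redone off lattice),
hyperbolic large scales free (ballisticity, renewal at singly crossed transversal geodesics). [deps:
ChainLaw] [difficulty: open-problem] -/
@[route_item "route-CriticalPhenomena-SAWPoincareChain", crux]
def SubCurvatureTightness : Prop :=
  ∀ Q : ℝ → Literature.Probability.RandomPlanarGeometry.ChordalFamily, (∀ᶠ t in nhdsWithin (0:ℝ) (Set.Ioi 0), (Q t).IsChordal ∧ (Q t).IsConformallyCovariant ∧ Literature.Probability.RandomPlanarGeometry.TendstoLaw (fun (_ : ℝ) (x : Literature.Probability.RandomPlanarGeometry.CurveClass ℂ) => x) (fun r => (fun S : MeasureTheory.Measure (Literature.Probability.RandomPlanarGeometry.CurveClass ℂ) => (S Set.univ)⁻¹ • S) ((fun (xc t ρ : ℝ) (pos : (ℕ → ℝ) → ℕ → ℂ) => MeasureTheory.Measure.sum fun n : ℕ => ENNReal.ofReal ((xc / (2 * Real.pi)) ^ n) • ((MeasureTheory.volume.restrict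 {θ : Fin n → ℝ | (∀ k, θ k ∈ Set.Ico (0:ℝ) (2 * Real.pi)) ∧ (∀ i j : ℕ, i + 2 ≤ j → j ≤ n → t * ‖1 - (starRingEnd ℂ) (pos (fun k => if h : k < n then θ ⟨k, h⟩ else 0) i) * pos (fun k => if h : k < n then θ ⟨k, h⟩ else 0) j‖ < ‖pos (fun k => if h : k < n then θ ⟨k, h⟩ else 0) i - pos (fun k => if h : k < n then θ ⟨k, h⟩ else 0) j‖) ∧ 2 * ‖pos (fun k => if h : k < n then θ ⟨k, h⟩ else 0) n + ↑ρ‖ ≤ ‖1 + ↑ρ * pos (fun k => if h : k < n then θ ⟨k, h⟩ else 0) n‖}).map (fun θ => Literature.Probability.RandomPlanarGeometry.CurveClass.mk (⟨Literature.Probability.LatticeModels.polyline ((List.range (n + 1)).map (pos (fun k => if h : k < n then θ ⟨k, h⟩ else 0)))⟩ : Literature.Probability.RandomPlanarGeometry.Curve ℂ)))) ((⨅ n : ℕ, ((MeasureTheory.volume {θ : Fin (n + 1) → ℝ | (∀ k, θ k ∈ Set.Ico (0:ℝ) (2 * Real.pi)) ∧ ∀ i j : ℕ, i + 2 ≤ j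 → j ≤ n + 1 → 1 < ‖(List.range i).foldl (fun (z : ℂ) (m : ℕ) => z + Complex.exp (↑(if h : m < n + 1 then θ ⟨m, h⟩ else 0) * Complex.I)) 0 - (List.range j).foldl (fun (z : ℂ) (m : ℕ) => z + Complex.exp (↑(if h : m < n + 1 then θ ⟨m, h⟩ else 0) * Complex.I)) 0‖}).toReal / (2 * Real.pi) ^ (n + 1)) ^ (1 / ((n : ℝ) + 1)))⁻¹) t (1 - r) (fun θ k => (List.range k).foldl (fun (z : ℂ) (j : ℕ) => (z + ↑t * Complex.exp (↑(θ j) * Complex.I)) / (1 + (starRingEnd ℂ) z * (↑t * Complex.exp (↑(θ j) * Complex.I)))) (↑(1 - r) : ℂ)))) id (Q t Literature.Probability.RandomPlanarGeometry.DobrushinDomain.unitDisc)) → Literature.Probability.RandomPlanarGeometry.IsTightAlongMesh (fun (_ : ℝ) (x : Literature.Probability.RandomPlanarGeometry.CurveClass ℂ) => x) (fun t => Q t Literature.Probability.RandomPlanarGeometry.DobrushinDomain.unitDisc) ∧ ∀ μ : MeasureTheory.Measure (Literature.Probability.RandomPlanarGeometry.CurveClass ℂ), MeasureTheory.IsProbabilityMeasure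 μ → Literature.Probability.RandomPlanarGeometry.IsSubseqLimitLaw (fun (_ : ℝ) (x : Literature.Probability.RandomPlanarGeometry.CurveClass ℂ) => x) (fun t => Q t Literature.Probability.RandomPlanarGeometry.DobrushinDomain.unitDisc) μ → ∀ᵐ γ ∂μ, γ ∈ Literature.Probability.RandomPlanarGeometry.CurveClass.simple ∧ γ.range ∩ frontier Literature.Probability.RandomPlanarGeometry.DobrushinDomain.unitDisc.carrier ⊆ {Literature.Probability.RandomPlanarGeometry.DobrushinDomain.unitDisc.pt 0, Literature.Probability.RandomPlanarGeometry.DobrushinDomain.unitDisc.pt 1}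

/-- item stmt-CriticalPhenomena-7558 · crux · rank 5 · open · by planner
why it might fail: Lattice universality is open with no mechanism (MadrasSlade1993 §1.1); Kennedy–Lawler lattice correction factors show endpoint-level non-universality, so only interior laws can agree — a different ℤ² limit, or none, kills this conjunct-facing step while the chain theory survives.
sources: MadrasSlade1993, doi:10.1090/conm/601/11958, arXiv:math/0112246, LawlerSchrammWerner2004SAW, DuminilCopinSmirnov2012
[crux] (card Z; conjunct-facing universality, NO mechanism claimed) For every Q with the ChainLaw
property, every Dobrushin domain (Ω; a, b) and every ℤ² endpoint approximation
(SAW.IsEndpointApprox) there is a step schedule e(δ) → 0+ along which the critical δℤ² SAW law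
(SAW.law, pushed to curves) and the chain law Q (e δ) (Ω;a,b) are asymptotically equal on bounded
continuous test functions. With the other cruxes this is equivalent to the conjunct; it isolates
lattice universality ℤ² ↔ Poincaré chain as the one ℤ²-specific statement of the line. [deps:
ChainLaw] [difficulty: open-problem] -/
@[route_item "route-CriticalPhenomena-SAWPoincareChain", crux]
def LatticeJoinsChain : Prop :=
  ∀ Q : ℝ → Literature.Probability.RandomPlanarGeometry.ChordalFamily, (∀ᶠ t in nhdsWithin (0:ℝ) (Set.Ioi 0), (Q t).IsChordal ∧ (Q t).IsConformallyCovariant ∧ Literature.Probability.RandomPlanarGeometry.TendstoLaw (fun (_ : ℝ) (x : Literature.Probability.RandomPlanarGeometry.CurveClass ℂ) => x) (fun r => (fun S : MeasureTheory.Measure (Literature.Probability.RandomPlanarGeometry.CurveClass ℂ) => (S Set.univ)⁻¹ • S) ((fun (xc t ρ : ℝ) (pos : (ℕ → ℝ) → ℕ → ℂ) => MeasureTheory.Measure.sum fun n : ℕ => ENNReal.ofReal ((xc / (2 * Real.pi)) ^ n) • ((MeasureTheory.volume.restrict {θ : Fin n → ℝ | (∀ k, θ k ∈ Set.Ico (0:ℝ)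 (2 * Real.pi)) ∧ (∀ i j : ℕ, i + 2 ≤ j → j ≤ n → t * ‖1 - (starRingEnd ℂ) (pos (fun k => if h : k < n then θ ⟨k, h⟩ else 0) i) * pos (fun k => if h : k < n then θ ⟨k, h⟩ else 0) j‖ < ‖pos (fun k => if h : k < n then θ ⟨k, h⟩ else 0) i - pos (fun k => if h : k < n then θ ⟨k, h⟩ else 0) j‖) ∧ 2 * ‖pos (fun k => if h : k < n then θ ⟨k, h⟩ else 0) n + ↑ρ‖ ≤ ‖1 + ↑ρ * pos (fun k => if h : k < n then θ ⟨k, h⟩ else 0) n‖}).map (fun θ => Literature.Probability.RandomPlanarGeometry.CurveClass.mk (⟨Literature.Probability.LatticeModels.polyline ((List.range (n + 1)).map (pos (fun k => if h : k < n then θ ⟨k, h⟩ else 0)))⟩ : Literature.Probability.RandomPlanarGeometry.Curve ℂ)))) ((⨅ n : ℕ, ((MeasureTheory.volume {θ : Fin (n + 1) → ℝ | (∀ k, θ k ∈ Set.Ico (0:ℝ) (2 * Real.pi)) ∧ ∀ i j : ℕ, i + 2 ≤ j → j ≤ n + 1 → 1 < ‖(List.range i).foldl (fun (z : ℂ) (m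 : ℕ) => z + Complex.exp (↑(if h : m < n + 1 then θ ⟨m, h⟩ else 0) * Complex.I)) 0 - (List.range j).foldl (fun (z : ℂ) (m : ℕ) => z + Complex.exp (↑(if h : m < n + 1 then θ ⟨m, h⟩ else 0) * Complex.I)) 0‖}).toReal / (2 * Real.pi) ^ (n + 1)) ^ (1 / ((n : ℝ) + 1)))⁻¹) t (1 - r) (fun θ k => (List.range k).foldl (fun (z : ℂ) (j : ℕ) => (z + ↑t * Complex.exp (↑(θ j) * Complex.I)) / (1 + (starRingEnd ℂ) z * (↑t * Complex.exp (↑(θ j) * Complex.I)))) (↑(1 - r) : ℂ)))) id (Q t Literature.Probability.RandomPlanarGeometry.DobrushinDomain.unitDisc)) → ∀ (D : Literature.Probability.RandomPlanarGeometry.DobrushinDomain) (a b : ℝ → Literature.Probability.LatticeModels.Site 2), Literature.Probability.RandomPlanarGeometry.SAW.IsEndpointApprox D a b → ∃ e : ℝ → ℝ, Filter.Tendsto e (nhdsWithin 0 (Set.Ioi 0)) (nhdsWithin 0 (Set.Ioi 0)) ∧ ∀ f : BoundedContinuousFunction (Literature.Probability.RandomPlanarGeometry.CurveClass ℂ) ℝ,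 Filter.Tendsto (fun δ => (∫ γ, f γ.curve ∂(Literature.Probability.RandomPlanarGeometry.SAW.law D.carrier δ (a δ) (b δ))) - ∫ x, f x ∂(Q (e δ) D)) (nhdsWithin 0 (Set.Ioi 0)) (nhds 0)

/-- item stmt-CriticalPhenomena-7559 · support · rank 9 · closed · proved by Summit.CriticalPhenomena.SAWScalingLimit.Theorems.discRestrictionIsSLE_proof (prover) · by planner
sources: LawlerSchrammWerner2003Restriction, Literature.Probability.RandomPlanarGeometry.LawlerSchrammWerner2003_holds
[support] LSW03 p.5 result 2 in ONE reference domain: a probability law on CurveClass ℂ carried by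
curves in the closed unit disc from 1 to −1, invariant under the disc automorphisms fixing 1 and −1
(pushed along any continuous extension), having the hull-restriction-with-transport property that
ObstacleIsMetric delivers, and carried by simple curves touching the circle only at ±1, is the
chordal SLE_{8/3} law of (𝔻;1,−1) (IsSLELaw (8/3) DobrushinDomain.unitDisc). Proof: transport μ
along Riemann maps (Carathéodory, Tietze for Φ) to a chordal family and apply the PROVED
Literature.Probability.RandomPlanarGeometry.LawlerSchrammWerner2003_holds, or pull back to ℍ and use
RestrictionUniqueness directly. [difficulty: L] -/
@[route_item "route-CriticalPhenomena-SAWPoincareChain", crux]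
def DiscRestrictionIsSLE : Prop :=
  ∀ μ : MeasureTheory.Measure (Literature.Probability.RandomPlanarGeometry.CurveClass ℂ), MeasureTheory.IsProbabilityMeasure μ → (∀ᵐ γ ∂μ, γ.source = Literature.Probability.RandomPlanarGeometry.DobrushinDomain.unitDisc.pt 0 ∧ γ.target = Literature.Probability.RandomPlanarGeometry.DobrushinDomain.unitDisc.pt 1 ∧ γ.range ⊆ closure Literature.Probability.RandomPlanarGeometry.DobrushinDomain.unitDisc.carrier) → (∀ (g : Literature.Probability.RandomPlanarGeometry.ConformalEquiv Literature.Probability.RandomPlanarGeometry.DobrushinDomain.unitDisc.carrier Literature.Probability.RandomPlanarGeometry.DobrushinDomain.unitDisc.carrier) (Φ : C(ℂ, ℂ)), g.HasBoundaryValue (Literature.Probability.RandomPlanarGeometry.DobrushinDomain.unitDisc.pt 0) (Literature.Probability.RandomPlanarGeometry.DobrushinDomain.unitDisc.pt 0) → g.HasBoundaryValue (Literature.Probability.RandomPlanarGeometry.DobrushinDomain.unitDisc.pt 1) (Literature.Probability.RandomPlanarGeometry.DobrushinDomain.unitDisc.pt 1) → Set.EqOn Φ g Literature.Probability.RandomPlanarGeometry.DobrushinDomain.unitDisc.carrier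 → μ.map (Literature.Probability.RandomPlanarGeometry.CurveClass.map Φ) = μ) → (∀ U : Literature.Probability.RandomPlanarGeometry.DobrushinDomain, Literature.Probability.RandomPlanarGeometry.MarkedDomain.IsHullSubdomain Literature.Probability.RandomPlanarGeometry.DobrushinDomain.unitDisc U → ∀ (g : Literature.Probability.RandomPlanarGeometry.ConformalEquiv Literature.Probability.RandomPlanarGeometry.DobrushinDomain.unitDisc.carrier U.carrier) (Φ : C(ℂ, ℂ)), g.HasBoundaryValue (Literature.Probability.RandomPlanarGeometry.DobrushinDomain.unitDisc.pt 0) (Literature.Probability.RandomPlanarGeometry.DobrushinDomain.unitDisc.pt 0) → g.HasBoundaryValue (Literature.Probability.RandomPlanarGeometry.DobrushinDomain.unitDisc.pt 1) (Literature.Probability.RandomPlanarGeometry.DobrushinDomain.unitDisc.pt 1) → Set.EqOn Φ g Literature.Probability.RandomPlanarGeometry.DobrushinDomain.unitDisc.carrier → ∀ T : Set (Literature.Probability.RandomPlanarGeometry.CurveClass ℂ), MeasurableSet T → μ.map (Literature.Probability.RandomPlanarGeometry.CurveClass.map Φ) T * μ (Literature.Probability.RandomPlanarGeometry.CurveClass.rangeSubset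 (closure U.carrier)) = μ (T ∩ Literature.Probability.RandomPlanarGeometry.CurveClass.rangeSubset (closure U.carrier))) → (∀ᵐ γ ∂μ, γ ∈ Literature.Probability.RandomPlanarGeometry.CurveClass.simple ∧ γ.range ∩ frontier Literature.Probability.RandomPlanarGeometry.DobrushinDomain.unitDisc.carrier ⊆ {Literature.Probability.RandomPlanarGeometry.DobrushinDomain.unitDisc.pt 0, Literature.Probability.RandomPlanarGeometry.DobrushinDomain.unitDisc.pt 1}) → Literature.Probability.RandomPlanarGeometry.IsSLELaw ((8 : NNReal) / 3) Literature.Probability.RandomPlanarGeometry.DobrushinDomain.unitDisc μ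

/-- item stmt-CriticalPhenomena-7560 · support · rank 9 · closed · proved by Summit.CriticalPhenomena.SAWScalingLimit.Theorems.DiscToDomains_proof (prover) · by planner
sources: LawlerSchrammWerner2004SAW, BillingsleyCPM1999, Literature.Probability.RandomPlanarGeometry.IsSLECurve.map_eq_holds
[support] Transport of convergence: if Q t is eventually chordal and exactly conformally covariant
and Q t (𝔻;1,−1) converges weakly as t → 0+ to an SLE_{8/3} law of the disc, then for every
Dobrushin domain D the laws Q t D converge to an SLE_{8/3} law of D (Riemann map 𝔻 → D with the two
boundary values, Tietze extension Φ, continuity of CurveClass.map Φ, and the SLE transport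
IsSLECurve.of_through / IsCompactifiedImage; uniqueness IsSLECurve.map_eq_holds). [difficulty: M] -/
@[route_item "route-CriticalPhenomena-SAWPoincareChain", crux]
def DiscToDomains : Prop :=
  ∀ Q : ℝ → Literature.Probability.RandomPlanarGeometry.ChordalFamily, (∀ᶠ t in nhdsWithin (0:ℝ) (Set.Ioi 0), (Q t).IsChordal ∧ (Q t).IsConformallyCovariant) → (∃ μ : MeasureTheory.Measure (Literature.Probability.RandomPlanarGeometry.CurveClass ℂ), Literature.Probability.RandomPlanarGeometry.IsSLELaw ((8 : NNReal) / 3) Literature.Probability.RandomPlanarGeometry.DobrushinDomain.unitDisc μ ∧ Literature.Probability.RandomPlanarGeometry.TendstoLaw (fun (_ : ℝ) (x : Literature.Probability.RandomPlanarGeometry.CurveClass ℂ) => x) (fun t => Q t Literature.Probability.RandomPlanarGeometry.DobrushinDomain.unitDisc) id μ) → ∀ D : Literature.Probability.RandomPlanarGeometry.DobrushinDomain, ∃ ν : MeasureTheory.Measure (Literature.Probability.RandomPlanarGeometry.CurveClass ℂ), Literature.Probability.RandomPlanarGeometry.IsSLELaw ((8 : NNReal) / 3) D ν ∧ Literature.Probability.RandomPlanarGeometry.TendstoLaw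 (fun (_ : ℝ) (x : Literature.Probability.RandomPlanarGeometry.CurveClass ℂ) => x) (fun t => Q t D) id ν

/-- item stmt-CriticalPhenomena-7561 · assembly · rank 1 · closed · proved by Summit.CriticalPhenomena.SAWScalingLimit.Theorems.sawPoincareChain_assembly_proof (prover) · by planner
sources: LawlerSchrammWerner2003Restriction, LawlerSchrammWerner2004SAW, BillingsleyCPM1999
[assembly] DiscRestrictionIsSLE → DiscToDomains → ChainLaw → SubCurvatureTightness →
ObstacleIsMetric → LatticeJoinsChain → SAWScalingLimit. -/
@[route_item "route-CriticalPhenomena-SAWPoincareChain", crux]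
def Assembly : Prop :=
  DiscRestrictionIsSLE → DiscToDomains → ChainLaw → SubCurvatureTightness → ObstacleIsMetric → LatticeJoinsChain → SAWScalingLimit

/-! D-0027 §2.1 — DECIDING THEOREM (planner-authored via `route open/edit --closes-file`; by planner-rbadge-CriticalPhenomena-SAWPoincareCh-fbba788d-g4-0 2026-08-15T16:10:34Z):
its hypotheses are this route's items and its conclusion the sub-problem Statement (glue_lint), and it elaborates with this file. -/

@[closes "route-CriticalPhenomena-SAWPoincareChain"] theorem closes
    (h_ObstacleIsMetric : ObstacleIsMetric) (h_ChainLaw : ChainLaw)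
    (h_SubCurvatureTightness : SubCurvatureTightness) (h_LatticeJoinsChain : LatticeJoinsChain)
    (h_DiscRestrictionIsSLE : DiscRestrictionIsSLE) (h_DiscToDomains : DiscToDomains)
    (h_Assembly : Assembly) : _root_.SAWScalingLimit :=
  h_Assembly h_DiscRestrictionIsSLE h_DiscToDomains h_ChainLaw h_SubCurvatureTightness
    h_ObstacleIsMetric h_LatticeJoinsChain

end Summit.CriticalPhenomena.SAWScalingLimit.Theses.SAWPoincareChain
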